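import Literature.Analysis.InnerProduct.RestrictedHilbertTensor

/-!
# The restricted Hilbert tensor product, II: slot maps `v ↦ ⊗(x; x_i := v)`

Topic `Analysis/InnerProduct`; continues `RestrictedHilbertTensor` (`Space 𝓔 = ⊗′_i (H_i, e_i)`, pure tensors
`tp 𝓔 x = ⊗x`, `⟪⊗x, ⊗y⟫ = ∏ ⟪x_i, y_i⟫` [Guichardet1972, App. A §A.1]).

* `kOff i x y = ∏_{j ≠ i} ⟪x_j, y_j⟫` — the kernel with the `i`-th factor removed; `kfun_eq_mul_kOff`;
* `slotₗ 𝓔 x i : H i →ₗ[ℂ] Space 𝓔`, `v ↦ ⊗(x; x_i := v)` — linear (`ext_inner_tp`) and continuous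
  (`continuous_slotₗ`, bound `∏_{j ≠ i} ‖x_j‖`, `norm_tp_update`);
* for a restricted family of UNIT vectors: the **slot isometry** `slot 𝓔 x hx i : H i →ₗᵢ[ℂ] Space 𝓔`
  (`norm_slotₗ_of_norm_eq_one`), `slot_apply_self : V_i x_i = ⊗x`, `norm_tp_of_norm_eq_one : ‖⊗x‖ = 1`.

These are the isometric embeddings `H_i → ⊗′ H`, `v ↦ v ⊗ (⊗_{j ≠ i} x_j)` of the factors along a decomposable
unit vector (Guichardet (1972), App. A §A.2, associativity for the partition `{i} ∪ (I - {i})`). Everything is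
proved (Mathlib only). Continued in `RestrictedHilbertTensorRep`.

## Provenance

Reproduced for the tree under the LEAN-IN-TREE rule (2026-08-18) from the pub-hodgecm cell's package file
`HodgeCM/PerL34/RestrictedTensor.lean` §3 (DAG-node prover #09 lineage, seat pv09-g6, gate run 27), verbatim up to
the namespace (`HodgeCM.PerL34.RestrictedTensor` ↦ `Literature.Analysis.InnerProduct.RestrictedTensor`) and the
added docstrings.
-/

set_option autoImplicit false

noncomputable section

open Function Set Filter
open scoped InnerProductSpace ComplexConjugate

namespace Literature.Analysis.InnerProduct.RestrictedTensor

universe u v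

variable {ι : Type u} {H : ι → Type v} [∀ i, NormedAddCommGroup (H i)]
  [∀ i, InnerProductSpace ℂ (H i)] {𝓔 : UnitFamily H}

open RVec

/-! ## §3 Slots: `v ↦ ⊗ (x with x_i := v)` -/

section slot

/-- The kernel with the `i`-th factor removed. [folklore] -/
def kOff (i : ι) (x y : RVec 𝓔) : ℂ := ∏ᶠ (j) (_ : j ≠ i), ⟪x j, y j⟫_ℂ

/-- `K(x, y) = ⟪x_i, y_i⟫ · K^{(i)}(x, y)`. [folklore] -/
theorem kfun_eq_mul_kOff (i : ι) (x y : RVec 𝓔) : kfun x y = ⟪x i, y i⟫_ℂ * kOff i x y :=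
  (mul_finprod_cond_ne i (hasFiniteMulSupport_inner x y)).symm

/-- `K^{(i)}(x, x) = 1` for a family of unit vectors. [folklore] -/
theorem kOff_self_of_norm_eq_one (i : ι) (x : RVec 𝓔) (hx : ∀ j, ‖x j‖ = 1) : kOff i x x = 1 :=
  finprod_eq_one_of_forall_eq_one fun j => by
    rw [show (fun _ : j ≠ i => ⟪x j, x j⟫_ℂ) = fun _ => 1 from funext fun _ => by
      rw [inner_self_eq_norm_sq_to_K, hx j]; simp]
    exact finprod_one

variable [DecidableEq ι]

/-- `K^{(i)}` ignores the `i`-th component of its right argument. [folklore] -/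
theorem kOff_update_right (i : ι) (x y : RVec 𝓔) (v : H i) :
    kOff i x (y.update i v) = kOff i x y :=
  finprod_congr fun j => finprod_congr fun hj => by rw [RVec.update_apply_of_ne _ hj]

/-- `K^{(i)}` ignores the `i`-th component of its left argument. [folklore] -/
theorem kOff_update_left (i : ι) (x y : RVec 𝓔) (v : H i) :
    kOff i (x.update i v) y = kOff i x y :=
  finprod_congr fun j => finprod_congr fun hj => by rw [RVec.update_apply_of_ne _ hj]

/-- `⟪⊗x, ⊗(y; y_i := v)⟫ = ⟪x_i, v⟫ · K^{(i)}(x, y)`. [folklore] -/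
theorem inner_tp_tp_update (x y : RVec 𝓔) (i : ι) (v : H i) :
    ⟪tp 𝓔 x, tp 𝓔 (y.update i v)⟫_ℂ = ⟪x i, v⟫_ℂ * kOff i x y := by
  rw [inner_tp_tp, kfun_eq_mul_kOff i, kOff_update_right, RVec.update_apply_same]

/-- `⟪⊗(x; x_i := v), ⊗(x; x_i := w)⟫ = ⟪v, w⟫ · K^{(i)}(x, x)`. [folklore] -/
theorem inner_tp_update_tp_update (x : RVec 𝓔) (i : ι) (v w : H i) :
    ⟪tp 𝓔 (x.update i v), tp 𝓔 (x.update i w)⟫_ℂ = ⟪v, w⟫_ℂ * kOff i x x := by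
  rw [inner_tp_tp_update, RVec.update_apply_same, kOff_update_left]

variable (𝓔) in
/-- The slot map `v ↦ ⊗ (x with x_i := v)` as a linear map. [folklore] -/
def slotₗ (x : RVec 𝓔) (i : ι) : H i →ₗ[ℂ] Space 𝓔 where
  toFun v := tp 𝓔 (x.update i v)
  map_add' v w := ext_inner_tp fun y => by
    simp only [inner_add_right, inner_tp_tp_update, add_mul]
  map_smul' c v := ext_inner_tp fun y => by
    simp only [inner_smul_right, inner_tp_tp_update, RingHom.id_apply, mul_assoc]

/-- The slot map on vectors: `V_i v = ⊗(x; x_i := v)`. [folklore] -/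
@[simp] theorem slotₗ_apply (x : RVec 𝓔) (i : ι) (v : H i) :
    slotₗ 𝓔 x i v = tp 𝓔 (x.update i v) := rfl

/-- The slot map of a family of unit vectors is isometric. [folklore] -/
theorem norm_slotₗ_of_norm_eq_one (x : RVec 𝓔) (hx : ∀ j, ‖x j‖ = 1) (i : ι) (v : H i) :
    ‖slotₗ 𝓔 x i v‖ = ‖v‖ := by
  have h : ((‖slotₗ 𝓔 x i v‖ ^ 2 : ℝ) : ℂ) = ((‖v‖ ^ 2 : ℝ) : ℂ) := by
    have h1 : ⟪slotₗ 𝓔 x i v, slotₗ 𝓔 x i v⟫_ℂ = ((‖slotₗ 𝓔 x i v‖ ^ 2 : ℝ) : ℂ) := by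
      rw [inner_self_eq_norm_sq_to_K]; norm_cast
    have h2 : ⟪v, v⟫_ℂ = ((‖v‖ ^ 2 : ℝ) : ℂ) := by
      rw [inner_self_eq_norm_sq_to_K]; norm_cast
    rw [← h1, ← h2, slotₗ_apply, inner_tp_update_tp_update, kOff_self_of_norm_eq_one i x hx,
      mul_one]
  have h' : ‖slotₗ 𝓔 x i v‖ ^ 2 = ‖v‖ ^ 2 := by exact_mod_cast h
  exact (pow_left_inj₀ (norm_nonneg _) (norm_nonneg _) two_ne_zero).mp h'

variable (𝓔) in
/-- **The slot isometry** `H i →ₗᵢ[ℂ] ⊗′ H`, `v ↦ ⊗ (x with x_i := v)`, for a restricted family `x`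
of unit vectors. [folklore] -/
def slot (x : RVec 𝓔) (hx : ∀ j, ‖x j‖ = 1) (i : ι) : H i →ₗᵢ[ℂ] Space 𝓔 :=
  { slotₗ 𝓔 x i with norm_map' := norm_slotₗ_of_norm_eq_one x hx i }

/-- The slot isometry on vectors. [folklore] -/
@[simp] theorem slot_apply (x : RVec 𝓔) (hx : ∀ j, ‖x j‖ = 1) (i : ι) (v : H i) :
    slot 𝓔 x hx i v = tp 𝓔 (x.update i v) := rfl

/-- `V_i(x_i) = ⊗x`. [folklore] -/
theorem slot_apply_self (x : RVec 𝓔) (hx : ∀ j, ‖x j‖ = 1) (i : ι) :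
    slot 𝓔 x hx i (x i) = tp 𝓔 x := by
  rw [slot_apply, RVec.update_eq_self]

end slot

/-- `‖⊗(x; x_i := v)‖ = ‖v‖ · ∏_{j ≠ i} ‖x_j‖`. [folklore] -/
theorem norm_tp_update [DecidableEq ι] (x : RVec 𝓔) (i : ι) (v : H i) :
    ‖tp 𝓔 (x.update i v)‖ = ‖v‖ * ∏ᶠ (j) (_ : j ≠ i), ‖x j‖ := by
  rw [norm_tp, ← mul_finprod_cond_ne i (hasFiniteMulSupport_norm (x.update i v)),
    RVec.update_apply_same]
  congr 1
  exact finprod_congr fun j => finprod_congr fun hj => by rw [RVec.update_apply_of_ne _ hj]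

/-- `‖⊗x‖ = 1` for a family of unit vectors. [folklore] -/
theorem norm_tp_of_norm_eq_one (x : RVec 𝓔) (hx : ∀ j, ‖x j‖ = 1) : ‖tp 𝓔 x‖ = 1 := by
  rw [norm_tp]; exact finprod_eq_one_of_forall_eq_one hx

/-- The slot map is continuous (it is bounded by `∏_{j ≠ i} ‖x_j‖`). [folklore] -/
theorem continuous_slotₗ [DecidableEq ι] (x : RVec 𝓔) (i : ι) : Continuous (slotₗ 𝓔 x i) :=
  AddMonoidHomClass.continuous_of_bound (slotₗ 𝓔 x i) (∏ᶠ (j) (_ : j ≠ i), ‖x j‖) fun v => by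
    rw [slotₗ_apply, norm_tp_update, mul_comm]

end Literature.Analysis.InnerProduct.RestrictedTensor
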